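import Mathlib
import Summits.Ventures.PercRepro.TriangleCapRowA
import Summits.Ventures.PercRepro.TriangleCapMaxDegStability

/-!
# PercRepro — THE ROW `r = a + 1` OF THE STABILITY TABLE AT A GENERAL `a`, THE PIECES: the window, the off-side
degree bound, the sides of an `a`-bipartite `D − z` (the all-off read through the max-degree stability of the other
bipartition: exactly the target `2k − 10`), and the deletion arithmetic (p3, gen 47; part 200t)

On `(k, a, a + 1)` the other bipartition `K_{a+1,k−a−1}` has `k − a` missing pairs — one more than a star at a
non-isolated vertex can hold — and its non-`a`-bipartite second best is the double broom (a `(k − a − 2)`-star and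
two more pairs at a second vertex, sharing leaves), `2k − 10` below the closed form: `closed_form_stability_bipSub_maxdeg`
of part 200q gives exactly this in the all-off read (`sides_A1_gen`; no vertex of the other bipartition misses
`k − a − 1` pairs: the small-side vertices of `D − z` keep `≥ k − 2a − 1` edges, `z` keeps `d ≥ 1`). The off-side
degree bound (`offside_deg_bound`, `K₄⁻`): an off-side neighbour of `z` is adjacent to at most one of the `t` in-side
neighbours of `z`, so its degree in `D − z` is `≤ a + 1 − t`. The deletions land on `(k − 1, a, d + 1)`: a `B2`
cell, the `T` cell, the `B2` cell `r = a − 1`, or the cell `r = a` of part 200p. Axioms: standard.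
-/

namespace PercRepro

namespace TriangleCap

namespace C047

open Finset

variable {V : Type*} [Fintype V] [DecidableEq V]

omit [DecidableEq V] in
/-- **THE WINDOW `[a, k − a − 1]` ON `(k, a, a + 1)`:** every degree in `[a, k − a − 1]` gives
`Σ_v d(v)² + (a + 1)(k − 1 − (a + 1)) + (2k − 10) ≤ m k` (`5 ≤ a`, `3a + 1 ≤ k`; slack `(a − 2) k − a² + a + 10`). -/
theorem rowA1_window (D : SimpleGraph V) [DecidableRel D.Adj] (a : ℕ) (ha5 : 5 ≤ a)
    (hk : 3 * a + 1 ≤ Fintype.card V) (hm : D.edgeFinset.card + (a + 1) = a * (Fintype.card V - a))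
    (hcap : ∀ v, deg D v + a + 1 ≤ Fintype.card V) (hdeg : ∀ v, a ≤ deg D v) :
    ∑ v, deg D v * deg D v + (a + 1) * (Fintype.card V - 1 - (a + 1)) + (2 * Fintype.card V - 10) ≤
      D.edgeFinset.card * Fintype.card V := by
  have hsum : ∑ v, (deg D v * deg D v + a * (Fintype.card V - a - 1)) ≤ ∑ v, (Fintype.card V - 1) * deg D v :=
    sum_le_sum (fun v _ => convex_vertex_window (deg D v) (Fintype.card V) a (hdeg v) (hcap v))
  rw [sum_add_distrib, sum_const, card_univ, smul_eq_mul, ← mul_sum, sum_deg_eq] at hsum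
  obtain ⟨k, hk'⟩ : ∃ k, Fintype.card V = k := ⟨_, rfl⟩
  obtain ⟨S, hS⟩ : ∃ S, ∑ v, deg D v * deg D v = S := ⟨_, rfl⟩
  obtain ⟨m, hmdef⟩ : ∃ m, D.edgeFinset.card = m := ⟨_, rfl⟩
  rw [hk'] at hsum hm hk
  rw [hS, hmdef] at hsum
  rw [hmdef] at hm
  rw [hS, hk', hmdef]
  obtain ⟨q, rfl⟩ : ∃ q, a = q + 5 := ⟨a - 5, by omega⟩
  obtain ⟨c, rfl⟩ : ∃ c, k = 3 * (q + 5) + 1 + c := ⟨k - (3 * (q + 5) + 1), by omega⟩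
  have e1 : 3 * (q + 5) + 1 + c - (q + 5) - 1 = 2 * q + 10 + c := by omega
  have e2 : 3 * (q + 5) + 1 + c - 1 = 3 * q + 15 + c := by omega
  have e3 : 3 * (q + 5) + 1 + c - (q + 5) = 2 * q + 11 + c := by omega
  have e4 : 3 * (q + 5) + 1 + c - 1 - (q + 5 + 1) = 2 * q + 9 + c := by omega
  have e5 : 2 * (3 * (q + 5) + 1 + c) - 10 = 6 * q + 22 + 2 * c := by omega
  rw [e1, e2] at hsum
  rw [e3] at hm
  rw [e4, e5]
  nlinarith [hsum, hm]

omit [Fintype V] in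
/-- A vertex's degree is at most the number of edges. -/
theorem deg_le_card_edges' [Fintype V] (H : SimpleGraph V) [DecidableRel H.Adj] (v : V) :
    deg H v ≤ H.edgeFinset.card := by
  rw [deg_eq_card_incidenceFinset]
  exact card_le_card (H.incidenceFinset_subset v)

/-- **THE OFF-SIDE DEGREE BOUND:** `D − z ⊆ K(A′, A′ᶜ)`, `w₀ ∉ A′` adjacent to `z` ⇒ `w₀` is adjacent (in `D − z`) to
at most one of the in-side neighbours of `z`: `deg (D − z) w₀ + |N(z) ∩ A′| ≤ |A′| + 1`. -/
theorem offside_deg_bound (D : SimpleGraph V) [DecidableRel D.Adj] (hK : K4mFree D) (z : V)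
    (A' : Finset {v : V // v ≠ z}) (hB : BipSub (del D z) A') (w₀ : {v : V // v ≠ z}) (hw₀A : w₀ ∉ A')
    (hw₀z : D.Adj w₀.1 z) :
    deg (del D z) w₀ + (A'.filter (fun w => D.Adj w.1 z)).card ≤ A'.card + 1 := by
  -- the neighbours of `w₀` lie in `A′`
  have hsub : univ.filter (fun w => (del D z).Adj w₀ w) ⊆ A' := by
    intro w hw
    rw [mem_filter] at hw
    have := hB w₀ w hw.2
    tauto
  -- at most one of them is a neighbour of `z`
  have hone : ((univ.filter (fun w => (del D z).Adj w₀ w)).filter (fun w => D.Adj w.1 z)).card ≤ 1 := by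
    by_contra hcon
    push Not at hcon
    obtain ⟨w₁, hw₁, w₂, hw₂, hne⟩ := one_lt_card.mp hcon
    rw [mem_filter, mem_filter] at hw₁ hw₂
    exact not_adj_both D hK (D.adj_symm hw₀z) (D.adj_symm hw₁.2) ((del_adj D z w₀ w₁).mp hw₁.1.2)
      (fun h => hne (Subtype.ext h)) (D.adj_symm hw₂.2) ((del_adj D z w₀ w₂).mp hw₂.1.2)
  have hsplit := card_filter_add_card_filter_not (s := univ.filter (fun w => (del D z).Adj w₀ w))
    (fun w => D.Adj w.1 z)
  have hoff : ((univ.filter (fun w => (del D z).Adj w₀ w)).filter (fun w => ¬ D.Adj w.1 z)).card ≤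
      (A'.filter (fun w => ¬ D.Adj w.1 z)).card :=
    card_le_card (fun w hw => by rw [mem_filter] at hw ⊢; exact ⟨hsub hw.1, hw.2⟩)
  have hA := card_filter_add_card_filter_not (s := A') (fun w => D.Adj w.1 z)
  unfold deg
  omega

/-- **THE SIDES OF AN `a`-BIPARTITE `D − z` ON THE CELL `(k, a, a + 1)`, `5 ≤ a`, `3a + 1 ≤ k`:** `D` is
`a`-bipartite, or at the target (all neighbours of `z` off the side: `(a + 1)`-bipartite with `k − a` missing pairs,
no vertex missing `k − a − 1` of them — the max-degree stability, exactly `2k − 10`), or `2 ≤ d(z)`, a neighbour of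
`z` lies off the `a`-side and `T + (k − a − 2) ≤ d(z)(k − a − 2) + a`. -/
theorem sides_A1_gen (D : SimpleGraph V) [DecidableRel D.Adj] (a : ℕ) (ha5 : 5 ≤ a)
    (hk : 3 * a + 1 ≤ Fintype.card V) (hm : D.edgeFinset.card + (a + 1) = a * (Fintype.card V - a)) (z : V)
    (hz : deg D z + 1 ≤ a) (A' : Finset {v : V // v ≠ z}) (hA'card : A'.card = a) (hB : BipSub (del D z) A')
    (hm' : (del D z).edgeFinset.card + (deg D z + 1) = a * (Fintype.card {v : V // v ≠ z} - a))
    (hcap : ∀ v, deg D v ≤ (Fintype.card V - a - 2) + 1) :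
    (∃ A : Finset V, A.card = a ∧ BipSub D A) ∨
      (∑ v, deg D v * deg D v + (a + 1) * (Fintype.card V - 1 - (a + 1)) + (2 * Fintype.card V - 10) ≤
        D.edgeFinset.card * Fintype.card V) ∨
      (2 ≤ deg D z ∧
        ∑ w : {v : V // v ≠ z}, (if D.Adj w.1 z then deg (del D z) w else 0) + (Fintype.card V - a - 2) ≤
          deg D z * (Fintype.card V - a - 2) + a) := by
  have hcard' := card_del z
  by_cases hall : ∀ w : {v : V // v ≠ z}, D.Adj w.1 z → w ∈ A'
  · obtain ⟨B, hBcard, hBsub⟩ := bipSub_lift D z A' hB hall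
    exact Or.inl ⟨B, by rw [hBcard, hA'card], hBsub⟩
  by_cases hnone : ∀ w : {v : V // v ≠ z}, D.Adj w.1 z → w ∉ A'
  · right; left
    push Not at hall
    obtain ⟨w₀, hw₀z, _⟩ := hall
    have hz1 : 1 ≤ deg D z := by
      have := card_nbhd_del D z
      have hmem : w₀ ∈ univ.filter (fun w : {v : V // v ≠ z} => D.Adj w.1 z) := by
        rw [mem_filter]; exact ⟨mem_univ _, hw₀z⟩
      have := card_pos.mpr ⟨w₀, hmem⟩
      omega
    have hAsub := bipSub_insert_map D z A' hB hnone
    have hAcard := card_insert_map z A'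
    rw [hA'card] at hAcard
    have hedges : D.edgeFinset.card + (Fintype.card V - a) = (a + 1) * (Fintype.card V - (a + 1)) := by
      have h := below_bip_edges a (a + 1) (Fintype.card V) D.edgeFinset.card (by omega) hm
      have e : Fintype.card V - 2 * a - 1 + (a + 1) = Fintype.card V - a := by omega
      rw [e] at h
      exact h
    -- no vertex misses `k − a − 1` pairs of the other bipartition
    have hmissdel := card_edges_missingGraph (del D z) A' hB a (deg D z + 1) hA'card hm'
    have hmax : ∀ v, deg (missingGraph D (insert z (A'.map (Function.Embedding.subtype _)))) v + 2 ≤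
        Fintype.card V - a := by
      intro v
      have h := deg_add_deg_missingGraph D _ hAsub v
      rw [hAcard] at h
      by_cases hvA : v ∈ insert z (A'.map (Function.Embedding.subtype _))
      · rw [if_pos hvA] at h
        -- `v = z` has degree `d ≥ 1`; `v ∈ A′` keeps `≥ k − 2a − 1 ≥ 1` edges
        have hdeg1 : 1 ≤ deg D v := by
          rw [mem_insert, mem_map] at hvA
          rcases hvA with rfl | ⟨w, hwA, hwv⟩
          · exact hz1
          · have hdel := deg_del D z w
            have hwz : ¬ D.Adj w.1 z := fun h => hnone w h hwA
            rw [if_neg hwz, add_zero] at hdel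
            have hmiss := deg_add_deg_missingGraph (del D z) A' hB w
            rw [if_pos hwA, hA'card] at hmiss
            have ec : Fintype.card {v : V // v ≠ z} = Fintype.card V - 1 := by omega
            rw [ec] at hmiss
            have hle := deg_le_card_edges' (missingGraph (del D z) A') w
            rw [hmissdel] at hle
            simp only [Function.Embedding.coe_subtype] at hwv
            rw [← hwv, ← hdel]
            omega
        omega
      · rw [if_neg hvA] at h
        omega
    have h := closed_form_stability_bipSub_maxdeg D _ hAsub (a + 1) (Fintype.card V - a) hAcard hedges (by omega)
      (by omega) hmax
    have e1 : Fintype.card V - 1 - (Fintype.card V - a) = a - 1 := by omega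
    rw [e1] at h
    have e2 : (Fintype.card V - a) * (a - 1) + 4 * (Fintype.card V - a - 3) =
        (a + 1) * (Fintype.card V - 1 - (a + 1)) + (2 * Fintype.card V - 10) := by
      obtain ⟨q, rfl⟩ : ∃ q, a = q + 5 := ⟨a - 5, by omega⟩
      obtain ⟨c, hc⟩ : ∃ c, Fintype.card V = 3 * (q + 5) + 1 + c := ⟨Fintype.card V - (3 * (q + 5) + 1), by omega⟩
      rw [hc]
      have f1 : 3 * (q + 5) + 1 + c - (q + 5) = 2 * q + 11 + c := by omega
      have f2 : q + 5 - 1 = q + 4 := by omega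
      have f3 : 2 * q + 11 + c - 3 = 2 * q + 8 + c := by omega
      have f4 : 3 * (q + 5) + 1 + c - 1 - (q + 5 + 1) = 2 * q + 9 + c := by omega
      have f5 : 2 * (3 * (q + 5) + 1 + c) - 10 = 6 * q + 22 + 2 * c := by omega
      rw [f1, f2, f3, f4, f5]
      ring
    omega
  · right; right
    push Not at hall hnone
    obtain ⟨w₀, hw₀z, hw₀A⟩ := hall
    obtain ⟨w₁, hw₁z, hw₁A⟩ := hnone
    have hne : w₀ ≠ w₁ := fun h => hw₀A (h ▸ hw₁A)
    obtain ⟨Nz, hNzdef⟩ : ∃ Nz : Finset {v : V // v ≠ z},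
        Nz = univ.filter (fun w : {v : V // v ≠ z} => D.Adj w.1 z) := ⟨_, rfl⟩
    have hmemNz : ∀ w : {v : V // v ≠ z}, w ∈ Nz ↔ D.Adj w.1 z := fun w => by
      rw [hNzdef, mem_filter]
      simp only [mem_univ, true_and]
    have hNz : Nz.card = deg D z := by rw [hNzdef]; exact card_nbhd_del D z
    refine ⟨?_, ?_⟩
    · have hsub : ({w₀, w₁} : Finset {v : V // v ≠ z}) ⊆ Nz := by
        intro w hw
        rw [mem_insert, mem_singleton] at hw
        rcases hw with rfl | rfl
        · exact (hmemNz _).mpr hw₀z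
        · exact (hmemNz _).mpr hw₁z
      have := card_le_card hsub
      rw [card_pair hne] at this
      omega
    · have hTfilt : ∑ w : {v : V // v ≠ z}, (if D.Adj w.1 z then deg (del D z) w else 0) =
          ∑ w ∈ Nz, deg (del D z) w := by
        rw [hNzdef, sum_filter]
      rw [hTfilt, ← hNz]
      have hdw₀ : deg (del D z) w₀ ≤ a := by
        have := deg_le_card_of_bipSub (del D z) A' hB w₀ hw₀A
        rw [hA'card] at this
        exact this
      exact sum_le_of_mem_le_gen Nz (fun w => deg (del D z) w) (Fintype.card V - a - 2) a ((hmemNz w₀).mpr hw₀z)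
        (fun w hw => by
          have h := deg_del D z w
          rw [if_pos ((hmemNz w).mp hw)] at h
          have := hcap w.1
          omega) hdw₀

end C047

end TriangleCap

end PercRepro
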